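import Mathlib
import HarnessLib
import Summits.KontsevichZagierPeriods.Zeta5Search.SorokinFirstVariable
import Summits.KontsevichZagierPeriods.Zeta5Search.SorokinLemma3

/-!
# ζ(5) search — Lemma 3' : the FIRST-variable recursion for Zudilin's `J_k` as a Barnes integral (cell `pub-zeta5`, ct-1 g28)

HONEST FRAMING: systematic search; no irrationality claim unless kernel-certified.  An identity of integrals (Mellin–Barnes under a
multiple integral, Fubini); nothing here is an irrationality result, a worthiness exponent or a denominator statement; no named fact
is discharged; no definition is introduced (inline integrands, g27's conventions).

Brick B6a (second half) of `HOME/ct-1/g28/VWP-BLUEPRINT-g28.md`.  With `SorokinFirstVariable.setIntegral_succ_eq_first` /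
`fibre_eq_first` and the joint integrability on `[0,1]^k × ℝ` (majorant = typed real `J_k`-integrand at `(t₀; Re a_{j+1} | Re b_{j+1})`
× `‖K(y)‖e^{π|y|}`, the latter integrable under the cut condition by g27's `BarnesKernelBounds.integrable_norm_kernel_mul_exp_pi`):

  **`lemma3_first`** (k+1 ≥ 2 variables, complex parameters, `s = −t₀+iy`, `ε = ±1`):
  `∫_{[0,1]^{k+1}} ∏_{j≤k} x_j^{a_j−1}(1−x_j)^{b_j−a_j−1} Q_{k+1}^{−a₀} dx
     = Γ(b_0−a_0)/Γ(a₀) · (1/2π) ∫_ℝ Γ(a₀+s)Γ(a_0+s)Γ(−s)/Γ(b_0+s) · e^{iεπs} ·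
         (∫_{[0,1]^k} ∏_{j<k} x_j^{a_{j+1}−1}(1−x_j)^{b_{j+1}−a_{j+1}−1} Q_k^{−(−s)} dx') dy`

— i.e. `J_{k+1}(a₀; a_0..a_k | b_0..b_k) = Γ(b_0−a_0)/Γ(a₀)·(1/2πi)∫ K(s) e^{iεπs} J_k(−s; a_1..a_k | b_1..b_k) ds`, the recursion that
replaces Zudilin's Lemma 3 in the corrected induction (the exponent `−s` of the inner `J_k` has `Re(−s) = t₀ > 0`, and the phase is
`±1` for EVERY parity of `k`).  [Zudilin math/0206177, Lemma 2–3; Nesterenko 2003, §3.2.]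

Theorems only; imports `Zeta5Search/SorokinFirstVariable`, `Zeta5Search/SorokinLemma3`.
-/

noncomputable section

namespace Summit.KontsevichZagierPeriods.Zeta5Search.SorokinLemma3First

open MeasureTheory Set Filter
open scoped Real
open Literature.NumberTheory.Irrationality.Zudilin2002 (nestedQ sorokinIntegrand)
open Literature.Analysis.SpecialFunctions.Hypergeometric (eulerIntegral)
open Summit.KontsevichZagierPeriods.Zeta5Search.SorokinIntegrandBounds
open Summit.KontsevichZagierPeriods.Zeta5Search.BarnesKernelBounds
open Summit.KontsevichZagierPeriods.Zeta5Search.SorokinFirstVariable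

variable {t₀ : ℝ} {a₀ : ℂ} {a b : ℕ → ℂ}

/-! ### 1. The joint integrand on `[0,1]^k × ℝ` -/

/-- Measurability of the joint integrand `(x', y) ↦ K(y) e^{iεπs} · [∏'(x') · Q_k(x')^{−(−s)}]`. -/
theorem measurable_joint_first (k : ℕ) (ht₀ : 0 < t₀) (ht₀' : t₀ < a₀.re) (hta : t₀ < (a 0).re) (htb : t₀ < (b 0).re) (ε : ℝ) :
    Measurable fun p : (Fin k → ℝ) × ℝ =>
      Complex.Gamma (a₀ + (-(t₀ : ℂ) + (p.2 : ℂ) * Complex.I)) * Complex.Gamma (a 0 + (-(t₀ : ℂ) + (p.2 : ℂ) * Complex.I)) *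
            Complex.Gamma (-(-(t₀ : ℂ) + (p.2 : ℂ) * Complex.I)) /
            Complex.Gamma (b 0 + (-(t₀ : ℂ) + (p.2 : ℂ) * Complex.I)) *
          Complex.exp (ε * π * Complex.I * (-(t₀ : ℂ) + (p.2 : ℂ) * Complex.I)) *
        ((∏ j : Fin k, ((p.1 j : ℝ) : ℂ) ^ (a (j + 1) - 1) * (1 - ((p.1 j : ℝ) : ℂ)) ^ (b (j + 1) - a (j + 1) - 1)) *
          ((nestedQ (List.ofFn p.1) : ℝ) : ℂ) ^ (-(-(-(t₀ : ℂ) + (p.2 : ℂ) * Complex.I)))) := by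
  have hK : Measurable fun p : (Fin k → ℝ) × ℝ =>
      Complex.Gamma (a₀ + (-(t₀ : ℂ) + (p.2 : ℂ) * Complex.I)) * Complex.Gamma (a 0 + (-(t₀ : ℂ) + (p.2 : ℂ) * Complex.I)) *
          Complex.Gamma (-(-(t₀ : ℂ) + (p.2 : ℂ) * Complex.I)) /
          Complex.Gamma (b 0 + (-(t₀ : ℂ) + (p.2 : ℂ) * Complex.I)) :=
    (continuous_kernel (a₀ := a₀) (a := a 0) (b := b 0) ht₀ ht₀' hta htb).measurable.comp measurable_snd
  have hs : Measurable fun p : (Fin k → ℝ) × ℝ => -(t₀ : ℂ) + (p.2 : ℂ) * Complex.I := by fun_prop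
  have hE : Measurable fun p : (Fin k → ℝ) × ℝ => Complex.exp (ε * π * Complex.I * (-(t₀ : ℂ) + (p.2 : ℂ) * Complex.I)) := by
    fun_prop
  have hQ : Measurable fun p : (Fin k → ℝ) × ℝ => ((nestedQ (List.ofFn p.1) : ℝ) : ℂ) :=
    Complex.measurable_ofReal.comp ((continuous_nestedQ_ofFn k).measurable.comp measurable_fst)
  refine (hK.mul hE).mul (Measurable.mul (Finset.measurable_prod _ fun j _ => ?_) (hQ.pow hs.neg.neg))
  have hj : Measurable fun p : (Fin k → ℝ) × ℝ => ((p.1 j : ℝ) : ℂ) :=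
    Complex.measurable_ofReal.comp ((measurable_pi_apply j).comp measurable_fst)
  exact (hj.pow_const _).mul ((measurable_const.sub hj).pow_const _)

/-- **Integrability of the joint integrand** on `[0,1]^k × ℝ`: dominated by the typed real `J_k`-integrand at
`(t₀; Re a_{j+1} | Re b_{j+1})` (assumed integrable on `[0,1]^k`) times `‖K(y)‖e^{π|y|}` (integrable under the cut condition
`Re a₀ + Re a_0 < Re b_0`). -/
theorem integrable_joint_first {k : ℕ} (ht₀ : 0 < t₀) (ht₀' : t₀ < a₀.re) (hta : t₀ < (a 0).re)
    (hb : a₀.re + (a 0).re < (b 0).re) {ε : ℝ} (hε : |ε| ≤ 1)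
    (hJ : IntegrableOn (sorokinIntegrand k t₀ (fun n => (a (n + 1)).re) (fun n => (b (n + 1)).re))
      (Set.pi univ fun _ : Fin k => Icc (0 : ℝ) 1) volume) :
    Integrable (fun p : (Fin k → ℝ) × ℝ =>
      Complex.Gamma (a₀ + (-(t₀ : ℂ) + (p.2 : ℂ) * Complex.I)) * Complex.Gamma (a 0 + (-(t₀ : ℂ) + (p.2 : ℂ) * Complex.I)) *
            Complex.Gamma (-(-(t₀ : ℂ) + (p.2 : ℂ) * Complex.I)) /
            Complex.Gamma (b 0 + (-(t₀ : ℂ) + (p.2 : ℂ) * Complex.I)) *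
          Complex.exp (ε * π * Complex.I * (-(t₀ : ℂ) + (p.2 : ℂ) * Complex.I)) *
        ((∏ j : Fin k, ((p.1 j : ℝ) : ℂ) ^ (a (j + 1) - 1) * (1 - ((p.1 j : ℝ) : ℂ)) ^ (b (j + 1) - a (j + 1) - 1)) *
          ((nestedQ (List.ofFn p.1) : ℝ) : ℂ) ^ (-(-(-(t₀ : ℂ) + (p.2 : ℂ) * Complex.I)))))
      (((volume : Measure (Fin k → ℝ)).restrict (Set.pi univ fun _ : Fin k => Icc (0 : ℝ) 1)).prod (volume : Measure ℝ)) := by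
  have htb : t₀ < (b 0).re := by linarith [lt_trans ht₀ hta]
  have hΨ : Integrable (fun y : ℝ => ‖Complex.Gamma (a₀ + (-(t₀ : ℂ) + (y : ℂ) * Complex.I)) *
        Complex.Gamma (a 0 + (-(t₀ : ℂ) + (y : ℂ) * Complex.I)) * Complex.Gamma (-(-(t₀ : ℂ) + (y : ℂ) * Complex.I)) /
        Complex.Gamma (b 0 + (-(t₀ : ℂ) + (y : ℂ) * Complex.I))‖ * Real.exp (π * |y|)) :=
    integrable_norm_kernel_mul_exp_pi (a₀ := a₀) (a := a 0) (b := b 0) ht₀ ht₀' hta htb hb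
  have hmaj := hJ.mul_prod hΨ
  have hae : (Set.pi univ fun _ : Fin k => Icc (0 : ℝ) 1) =ᵐ[volume] (Set.pi univ fun _ : Fin k => Ioo (0 : ℝ) 1) := by
    rw [volume_pi]; exact Measure.pi_Ioo_ae_eq_pi_Icc.symm
  refine hmaj.mono' (measurable_joint_first k ht₀ ht₀' hta htb ε).aestronglyMeasurable ?_
  rw [IntegrableOn, Measure.restrict_congr_set hae] at hJ
  rw [Measure.restrict_congr_set hae, ← Measure.restrict_univ (μ := (volume : Measure ℝ)), Measure.prod_restrict]
  filter_upwards [ae_restrict_mem ((MeasurableSet.univ_pi fun _ => measurableSet_Ioo).prod MeasurableSet.univ)] with p hp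
  have hx : ∀ j, p.1 j ∈ Ioo (0 : ℝ) 1 := fun j => (mem_prod.1 hp).1 j (mem_univ _)
  have hS := norm_bracket a b t₀ p.2 hx
  have hnn : 0 ≤ sorokinIntegrand k t₀ (fun n => (a (n + 1)).re) (fun n => (b (n + 1)).re) p.1 := by
    rw [← hS]; exact norm_nonneg _
  rw [norm_mul, norm_mul, hS]
  calc _ ≤ ‖Complex.Gamma (a₀ + (-(t₀ : ℂ) + (p.2 : ℂ) * Complex.I)) * Complex.Gamma (a 0 + (-(t₀ : ℂ) + (p.2 : ℂ) * Complex.I)) *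
            Complex.Gamma (-(-(t₀ : ℂ) + (p.2 : ℂ) * Complex.I)) /
            Complex.Gamma (b 0 + (-(t₀ : ℂ) + (p.2 : ℂ) * Complex.I))‖ * Real.exp (π * |p.2|) *
          sorokinIntegrand k t₀ (fun n => (a (n + 1)).re) (fun n => (b (n + 1)).re) p.1 :=
        mul_le_mul_of_nonneg_right (mul_le_mul_of_nonneg_left (SorokinLemma3.norm_phase_le hε t₀ p.2) (norm_nonneg _)) hnn
    _ = _ := by ring

/-! ### 2. Lemma 3' -/

/-- **Lemma 3' (first-variable recursion)** [corrected route of `VWP-BLUEPRINT-g28.md` §3; Zudilin math/0206177, Lemmas 2–3],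
complex parameters, 0-indexed with `k+1 ≥ 2` variables: for `0 < t₀ < Re a₀`, `t₀ < Re a_0`, `Re a₀ + Re a_0 < Re b_0`, `ε = ±1`, and
provided the `J_{k+1}`-integrand is integrable on `[0,1]^{k+1}` and the typed `J_k`-integrand at `(t₀; Re a_{j+1} | Re b_{j+1})` is
integrable on `[0,1]^k`,
`∫_{[0,1]^{k+1}} ∏ x_j^{a_j−1}(1−x_j)^{b_j−a_j−1} Q_{k+1}^{−a₀} dx
   = Γ(b_0−a_0)/Γ(a₀) · (1/2π) ∫_ℝ Γ(a₀+s)Γ(a_0+s)Γ(−s)/Γ(b_0+s) · e^{iεπs} ·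
       (∫_{[0,1]^k} ∏_{j<k} x_j^{a_{j+1}−1}(1−x_j)^{b_{j+1}−a_{j+1}−1} Q_k^{−(−s)} dx') dy`, `s = −t₀+iy`. -/
theorem lemma3_first {k : ℕ} (hk : 1 ≤ k) (ht₀ : 0 < t₀) (ht₀' : t₀ < a₀.re) (hta : t₀ < (a 0).re)
    (hb : a₀.re + (a 0).re < (b 0).re) {ε : ℝ} (hε : ε = 1 ∨ ε = -1)
    (hF : IntegrableOn (fun x : Fin (k + 1) → ℝ =>
      (∏ j : Fin (k + 1), ((x j : ℝ) : ℂ) ^ (a j - 1) * (1 - ((x j : ℝ) : ℂ)) ^ (b j - a j - 1)) *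
        ((nestedQ (List.ofFn x) : ℝ) : ℂ) ^ (-a₀)) (Set.pi univ fun _ : Fin (k + 1) => Icc (0 : ℝ) 1) volume)
    (hJ : IntegrableOn (sorokinIntegrand k t₀ (fun n => (a (n + 1)).re) (fun n => (b (n + 1)).re))
      (Set.pi univ fun _ : Fin k => Icc (0 : ℝ) 1) volume) :
    ∫ x in Set.pi univ (fun _ : Fin (k + 1) => Icc (0 : ℝ) 1),
        (∏ j : Fin (k + 1), ((x j : ℝ) : ℂ) ^ (a j - 1) * (1 - ((x j : ℝ) : ℂ)) ^ (b j - a j - 1)) *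
          ((nestedQ (List.ofFn x) : ℝ) : ℂ) ^ (-a₀) =
      Complex.Gamma (b 0 - a 0) / Complex.Gamma a₀ *
        ((1 / (2 * π) : ℂ) * ∫ y : ℝ,
          Complex.Gamma (a₀ + (-(t₀ : ℂ) + (y : ℂ) * Complex.I)) * Complex.Gamma (a 0 + (-(t₀ : ℂ) + (y : ℂ) * Complex.I)) *
                Complex.Gamma (-(-(t₀ : ℂ) + (y : ℂ) * Complex.I)) /
                Complex.Gamma (b 0 + (-(t₀ : ℂ) + (y : ℂ) * Complex.I)) *
              Complex.exp (ε * π * Complex.I * (-(t₀ : ℂ) + (y : ℂ) * Complex.I)) *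
            ∫ x' in Set.pi univ (fun _ : Fin k => Icc (0 : ℝ) 1),
              (∏ j : Fin k, ((x' j : ℝ) : ℂ) ^ (a (j + 1) - 1) * (1 - ((x' j : ℝ) : ℂ)) ^ (b (j + 1) - a (j + 1) - 1)) *
                ((nestedQ (List.ofFn x') : ℝ) : ℂ) ^ (-(-(-(t₀ : ℂ) + (y : ℂ) * Complex.I)))) := by
  have hεabs : |ε| ≤ 1 := by
    rcases hε with h | h <;> simp [h]
  set H : (Fin k → ℝ) → ℝ → ℂ := fun x' y =>
    Complex.Gamma (a₀ + (-(t₀ : ℂ) + (y : ℂ) * Complex.I)) * Complex.Gamma (a 0 + (-(t₀ : ℂ) + (y : ℂ) * Complex.I)) *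
          Complex.Gamma (-(-(t₀ : ℂ) + (y : ℂ) * Complex.I)) /
          Complex.Gamma (b 0 + (-(t₀ : ℂ) + (y : ℂ) * Complex.I)) *
        Complex.exp (ε * π * Complex.I * (-(t₀ : ℂ) + (y : ℂ) * Complex.I)) *
      ((∏ j : Fin k, ((x' j : ℝ) : ℂ) ^ (a (j + 1) - 1) * (1 - ((x' j : ℝ) : ℂ)) ^ (b (j + 1) - a (j + 1) - 1)) *
        ((nestedQ (List.ofFn x') : ℝ) : ℂ) ^ (-(-(-(t₀ : ℂ) + (y : ℂ) * Complex.I)))) with hHdef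
  have hHint : Integrable (Function.uncurry H)
      (((volume : Measure (Fin k → ℝ)).restrict (Set.pi univ fun _ : Fin k => Icc (0 : ℝ) 1)).prod (volume : Measure ℝ)) := by
    rw [hHdef]
    exact integrable_joint_first ht₀ ht₀' hta hb hεabs hJ
  -- (1) split off the first variable
  rw [setIntegral_succ_eq_first k a₀ a b hF]
  -- (2) fibrewise: the Euler integral as a Barnes integral (a.e. `x'`, on the open cube)
  have hae : (Set.pi univ fun _ : Fin k => Icc (0 : ℝ) 1) =ᵐ[volume] (Set.pi univ fun _ : Fin k => Ioo (0 : ℝ) 1) := by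
    rw [volume_pi]; exact Measure.pi_Ioo_ae_eq_pi_Icc.symm
  have hopen : ∀ᵐ x' ∂((volume : Measure (Fin k → ℝ)).restrict (Set.pi univ fun _ : Fin k => Icc (0 : ℝ) 1)),
      ∀ j, x' j ∈ Ioo (0 : ℝ) 1 := by
    rw [Measure.restrict_congr_set hae]
    filter_upwards [ae_restrict_mem (MeasurableSet.univ_pi fun _ => measurableSet_Ioo)] with x hx
    exact fun j => hx j (mem_univ _)
  have hfibre : ∀ᵐ x' ∂((volume : Measure (Fin k → ℝ)).restrict (Set.pi univ fun _ : Fin k => Icc (0 : ℝ) 1)),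
      (∏ j : Fin k, ((x' j : ℝ) : ℂ) ^ (a (j + 1) - 1) * (1 - ((x' j : ℝ) : ℂ)) ^ (b (j + 1) - a (j + 1) - 1)) *
          eulerIntegral a₀ (a 0) (b 0) ((nestedQ (List.ofFn x') : ℝ) : ℂ) =
        Complex.Gamma (b 0 - a 0) / Complex.Gamma a₀ * ((1 / (2 * π) : ℂ) * ∫ y : ℝ, H x' y) := by
    filter_upwards [hopen] with x' hx'
    rw [hHdef]
    exact fibre_eq_first hk ht₀ ht₀' hta hb hx' hε
  rw [integral_congr_ae hfibre, integral_const_mul, integral_const_mul]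
  -- (3) swap the `x'`- and `y`-integrals
  rw [integral_integral_swap hHint]
  -- (4) pull the `y`-factors out of the inner `x'`-integral
  congr 2
  refine integral_congr_ae (Eventually.of_forall fun y => ?_)
  rw [hHdef]
  simp only
  rw [← integral_const_mul]

end Summit.KontsevichZagierPeriods.Zeta5Search.SorokinLemma3First

end
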